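import Mathlib
import Summits.PneNP.PneNP.Theorems.SfmBlDiscToCut
import Summits.PneNP.PneNP.Theorems.SfmBlConnectedPairs

/-!
# Deterministic local accounting on a dense spot — line «sfm-bl» (PROOF-SFM-BL Proposition 9, the lever L3)

FRONTIER F-N1c; nothing here bears on P vs NP.

ABSTRACT, DEFINITION-FREE FORM.  A SPOT is a bipartite multigraph inside ambient vertex types `α`
(one side) and `β` (other side): edges `e : E` with endpoints `src e ∈ V₁ ⊆ α`, `dst e ∈ V₂ ⊆ β`, each
carrying a real sign `s e` with `|s e| ≤ 1` (in the sfm-bl argument `s e = χ(T_{out e})`, shared by the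
≤ 3 legs of one output).  Its signed biadjacency is the matrix `M` with `M i j = Σ_{e : i → j} s e` (taken
as a HYPOTHESIS `hM`, so that no definition is introduced).  `G` is any simple graph on `α ⊕ β` containing
every edge (`hG`).  Let `(B₁, B₂)` be any pair of vertex sets such that every `G`-connected pair
`(W₁, W₂)` DISJOINT from `(B₁, B₂)` has discrepancy `|Σ_{i∈W₁} Σ_{j∈W₂} M i j| ≤ γ·√(|W₁|·|W₂|)`
(`hgood`; in PROOF-SFM-BL `B = B_S(T)` is the union of the γ′-BAD connected pairs, and a connected pair
outside `B` is not bad).  THEN for all `±1` vectors `σ, φ`: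

  `σᵀ M φ ≤ 2γ·√(|V₁|·|V₂|) + #{e : src e ∈ B₁ ∨ dst e ∈ B₂}`      (`spot_cut_le`)

i.e. `Γ_S(T) ≤ 2γ′√(s₁s₂) + e_B(T)`.  Proof as in the memo: split `M = M′ + M″` (entries meeting `B` /
entries outside `B`); `σᵀM″φ ≤ Σ_{e meets B} |s e| ≤ e_B`; on `M′` every connected pair of the graph
`G′ := G` minus the vertices of `B` avoids `B`, is `G`-connected and has `M′`-discrepancy =
`M`-discrepancy, so `hgood` applies; `SfmBl.disc_of_connected_pairs` (Lemma 3) extends the bound to all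
0/1 pairs and `sfmBl_discToCut` (Lemma 8) — transported here to matrices supported on `V₁ × V₂` inside
arbitrary finite index types (`discToCut_supported`) — converts it to `|σᵀM′φ| ≤ 2γ√(|V₁||V₂|)`.  With
the extraction density `#E > 60γ·√(|V₁||V₂|)` this reads `Γ_S < #E/30 + e_B` (`spot_cut_lt_of_dense`).
-/

namespace Summit.PneNP.PneNP.Theorems.SfmBl

open Matrix Finset BigOperators

/-- Regrouping a double sum over endpoint fibres into a sum over edges:
`Σ_i Σ_j Σ_{e : src e = i, dst e = j} g e = Σ_e g e`. -/
theorem sum_sum_fiber_eq {α β E : Type*} [Fintype α] [Fintype β] [Fintype E] [DecidableEq α]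
    [DecidableEq β] (src : E → α) (dst : E → β) (g : E → ℝ) :
    ∑ i, ∑ j, ∑ e ∈ Finset.univ.filter (fun e => src e = i ∧ dst e = j), g e = ∑ e, g e := by
  classical
  have key : ∀ e : E, ∑ i : α, ∑ j : β, (if src e = i ∧ dst e = j then g e else 0) = g e := by
    intro e
    rw [Finset.sum_eq_single (src e), Finset.sum_eq_single (dst e)]
    · simp
    · intro j _ hj; simp [Ne.symm hj]
    · simp
    · intro i _ hi; exact Finset.sum_eq_zero fun j _ => by simp [Ne.symm hi]
    · simp
  calc ∑ i, ∑ j, ∑ e ∈ Finset.univ.filter (fun e => src e = i ∧ dst e = j), g e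
      = ∑ i : α, ∑ j : β, ∑ e, (if src e = i ∧ dst e = j then g e else 0) := by
        refine Finset.sum_congr rfl fun i _ => Finset.sum_congr rfl fun j _ => ?_
        rw [Finset.sum_filter]
    _ = ∑ i : α, ∑ e, ∑ j : β, (if src e = i ∧ dst e = j then g e else 0) :=
        Finset.sum_congr rfl fun i _ => Finset.sum_comm
    _ = ∑ e, ∑ i : α, ∑ j : β, (if src e = i ∧ dst e = j then g e else 0) := Finset.sum_comm
    _ = ∑ e, g e := Finset.sum_congr rfl fun e _ => key e

/-- The bilinear form of a matrix supported on `V₁ × V₂` only sees `V₁ × V₂`. -/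
theorem bilin_eq_sum_support {α β : Type*} [Fintype α] [Fintype β] (M : Matrix α β ℝ)
    (V₁ : Finset α) (V₂ : Finset β) (hV : ∀ i j, M i j ≠ 0 → i ∈ V₁ ∧ j ∈ V₂) (f : α → ℝ) (g : β → ℝ) :
    f ⬝ᵥ (M *ᵥ g) = ∑ i ∈ V₁, ∑ j ∈ V₂, f i * M i j * g j := by
  classical
  have h1 : f ⬝ᵥ (M *ᵥ g) = ∑ i, ∑ j, f i * M i j * g j := by
    simp only [dotProduct, Matrix.mulVec, Finset.mul_sum, mul_assoc]
  rw [h1, ← Finset.sum_subset (Finset.subset_univ V₁)]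
  · refine Finset.sum_congr rfl fun i _ => ?_
    rw [← Finset.sum_subset (Finset.subset_univ V₂)]
    intro j _ hj
    have : M i j = 0 := by by_contra h; exact hj (hV i j h).2
    simp [this]
  · intro i _ hi
    refine Finset.sum_eq_zero fun j _ => ?_
    have : M i j = 0 := by by_contra h; exact hi (hV i j h).1
    simp [this]

/-- `DiscToCut` (p3's `sfmBl_discToCut`, stated for `Fin a × Fin b`) TRANSPORTED to a matrix supported on
`V₁ × V₂` inside arbitrary finite index types: the 0/1 discrepancy bound at level `γ` gives
`|σᵀMφ| ≤ 2γ√(|V₁||V₂|)` for all `±1` vectors. -/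
theorem discToCut_supported {α β : Type*} [Fintype α] [Fintype β] [DecidableEq α] [DecidableEq β]
    (M : Matrix α β ℝ) (V₁ : Finset α) (V₂ : Finset β)
    (hV : ∀ i j, M i j ≠ 0 → i ∈ V₁ ∧ j ∈ V₂) {γ : ℝ} (hγ : 0 ≤ γ)
    (hD : ∀ (u : α → ℝ) (v : β → ℝ), (∀ i, u i = 0 ∨ u i = 1) → (∀ j, v j = 0 ∨ v j = 1) →
      |u ⬝ᵥ (M *ᵥ v)| ≤ γ * Real.sqrt ((∑ i, u i) * (∑ j, v j)))
    (σ : α → ℝ) (φ : β → ℝ) (hσ : ∀ i, σ i = 1 ∨ σ i = -1) (hφ : ∀ j, φ j = 1 ∨ φ j = -1) :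
    |σ ⬝ᵥ (M *ᵥ φ)| ≤ 2 * γ * Real.sqrt ((V₁.card : ℝ) * (V₂.card : ℝ)) := by
  classical
  -- enumerate the supports
  set a := V₁.card with ha
  set b := V₂.card with hb
  let e₁ : Fin a ≃ V₁ := V₁.equivFin.symm
  let e₂ : Fin b ≃ V₂ := V₂.equivFin.symm
  let M₀ : Matrix (Fin a) (Fin b) ℝ := fun i j => M (e₁ i) (e₂ j)
  -- restriction of vectors
  let r₁ : (α → ℝ) → (Fin a → ℝ) := fun f i => f (e₁ i)
  let r₂ : (β → ℝ) → (Fin b → ℝ) := fun g j => g (e₂ j)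
  -- (i) the bilinear form is computed on the supports
  have hres : ∀ (f : α → ℝ) (g : β → ℝ), f ⬝ᵥ (M *ᵥ g) = (r₁ f) ⬝ᵥ (M₀ *ᵥ (r₂ g)) := by
    intro f g
    rw [bilin_eq_sum_support M V₁ V₂ hV f g]
    have h2 : (r₁ f) ⬝ᵥ (M₀ *ᵥ (r₂ g)) = ∑ i : Fin a, ∑ j : Fin b, f (e₁ i) * M (e₁ i) (e₂ j) * g (e₂ j) := by
      simp only [dotProduct, Matrix.mulVec, Finset.mul_sum, mul_assoc, r₁, r₂, M₀]
    rw [h2]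
    rw [← Finset.sum_coe_sort V₁]
    rw [← e₁.sum_comp]
    refine Finset.sum_congr rfl fun i _ => ?_
    rw [← Finset.sum_coe_sort V₂, ← e₂.sum_comp]
  -- (ii) sums of restricted 0/1 vectors
  -- extension of a vector on `Fin a` to `α` (zero off `V₁`)
  let x₁ : (Fin a → ℝ) → (α → ℝ) := fun u₀ i => if h : i ∈ V₁ then u₀ (e₁.symm ⟨i, h⟩) else 0
  let x₂ : (Fin b → ℝ) → (β → ℝ) := fun v₀ j => if h : j ∈ V₂ then v₀ (e₂.symm ⟨j, h⟩) else 0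
  have hr₁x₁ : ∀ u₀, r₁ (x₁ u₀) = u₀ := by
    intro u₀; funext i
    simp only [r₁, x₁, Finset.coe_mem, dite_true]
    congr 1
    rw [Equiv.symm_apply_eq]
  have hr₂x₂ : ∀ v₀, r₂ (x₂ v₀) = v₀ := by
    intro v₀; funext j
    simp only [r₂, x₂, Finset.coe_mem, dite_true]
    congr 1
    rw [Equiv.symm_apply_eq]
  have hsum₁ : ∀ u₀ : Fin a → ℝ, ∑ i, x₁ u₀ i = ∑ i, u₀ i := by
    intro u₀
    rw [← Finset.sum_subset (Finset.subset_univ V₁)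
      (fun i _ hi => by simp only [x₁, hi, dite_false])]
    rw [← Finset.sum_coe_sort V₁, ← e₁.sum_comp]
    refine Finset.sum_congr rfl fun i _ => ?_
    have := congr_fun (hr₁x₁ u₀) i
    simpa only [r₁] using this
  have hsum₂ : ∀ v₀ : Fin b → ℝ, ∑ j, x₂ v₀ j = ∑ j, v₀ j := by
    intro v₀
    rw [← Finset.sum_subset (Finset.subset_univ V₂)
      (fun j _ hj => by simp only [x₂, hj, dite_false])]
    rw [← Finset.sum_coe_sort V₂, ← e₂.sum_comp]
    refine Finset.sum_congr rfl fun j _ => ?_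
    have := congr_fun (hr₂x₂ v₀) j
    simpa only [r₂] using this
  -- (iii) the discrepancy hypothesis for `M₀`
  have hD₀ : ∀ (u₀ : Fin a → ℝ) (v₀ : Fin b → ℝ), (∀ i, u₀ i = 0 ∨ u₀ i = 1) → (∀ j, v₀ j = 0 ∨ v₀ j = 1) →
      |u₀ ⬝ᵥ (M₀.mulVec v₀)| ≤ γ * Real.sqrt ((∑ i, u₀ i) * (∑ j, v₀ j)) := by
    intro u₀ v₀ hu₀ hv₀
    have hu : ∀ i, x₁ u₀ i = 0 ∨ x₁ u₀ i = 1 := by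
      intro i; by_cases h : i ∈ V₁
      · simp only [x₁, h, dite_true]; exact hu₀ _
      · simp only [x₁, h, dite_false]; exact Or.inl trivial
    have hv : ∀ j, x₂ v₀ j = 0 ∨ x₂ v₀ j = 1 := by
      intro j; by_cases h : j ∈ V₂
      · simp only [x₂, h, dite_true]; exact hv₀ _
      · simp only [x₂, h, dite_false]; exact Or.inl trivial
    have h := hD (x₁ u₀) (x₂ v₀) hu hv
    rw [hres, hr₁x₁, hr₂x₂, hsum₁, hsum₂] at h
    exact h
  -- (iv) apply the `Fin`-indexed lemma and transport back
  have hσ₀ : ∀ i, r₁ σ i = 1 ∨ r₁ σ i = -1 := fun i => hσ _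
  have hφ₀ : ∀ j, r₂ φ j = 1 ∨ r₂ φ j = -1 := fun j => hφ _
  have h := sfmBl_discToCut M₀ hγ hD₀ (r₁ σ) (r₂ φ) hσ₀ hφ₀
  rw [hres]
  exact h

/-- **PROPOSITION 9 (deterministic spot accounting).**  See the module docstring: for a signed bipartite
multigraph with sides `V₁ ⊆ α`, `V₂ ⊆ β` and `|s e| ≤ 1`, any graph `G` containing its edges and any
`(B₁, B₂)` outside of which every `G`-connected pair has discrepancy `≤ γ√(|W₁||W₂|)`, every `±1` cut
value satisfies `σᵀMφ ≤ 2γ√(|V₁||V₂|) + #{edges meeting B₁ ∪ B₂}`. -/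
theorem spot_cut_le {α β E : Type*} [Fintype α] [Fintype β] [Fintype E] [DecidableEq α] [DecidableEq β]
    (src : E → α) (dst : E → β) (V₁ : Finset α) (V₂ : Finset β) (hE : ∀ e, src e ∈ V₁ ∧ dst e ∈ V₂)
    (s : E → ℝ) (hs : ∀ e, |s e| ≤ 1)
    (M : Matrix α β ℝ)
    (hM : ∀ i j, M i j = ∑ e ∈ Finset.univ.filter (fun e => src e = i ∧ dst e = j), s e)
    (G : SimpleGraph (α ⊕ β)) (hG : ∀ e, G.Adj (Sum.inl (src e)) (Sum.inr (dst e)))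
    {γ : ℝ} (hγ : 0 ≤ γ) (B₁ : Finset α) (B₂ : Finset β)
    (hgood : ∀ (W₁ : Finset α) (W₂ : Finset β), Disjoint W₁ B₁ → Disjoint W₂ B₂ →
      (G.induce {x | Sum.elim (fun i => i ∈ W₁) (fun j => j ∈ W₂) x}).Connected →
      |∑ i ∈ W₁, ∑ j ∈ W₂, M i j| ≤ γ * Real.sqrt ((W₁.card : ℝ) * (W₂.card : ℝ)))
    (σ : α → ℝ) (φ : β → ℝ) (hσ : ∀ i, σ i = 1 ∨ σ i = -1) (hφ : ∀ j, φ j = 1 ∨ φ j = -1) :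
    σ ⬝ᵥ (M *ᵥ φ) ≤ 2 * γ * Real.sqrt ((V₁.card : ℝ) * (V₂.card : ℝ))
      + ((Finset.univ.filter fun e => src e ∈ B₁ ∨ dst e ∈ B₂).card : ℝ) := by
  classical
  -- `M` is supported on `V₁ × V₂`
  have hMsupp : ∀ i j, M i j ≠ 0 → i ∈ V₁ ∧ j ∈ V₂ := by
    intro i j hij
    rw [hM i j] at hij
    obtain ⟨e, he, _⟩ := Finset.exists_ne_zero_of_sum_ne_zero hij
    simp only [Finset.mem_filter, Finset.mem_univ, true_and] at he
    rw [← he.1, ← he.2]; exact hE e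
  -- the split `M = M' + M''`: `M'` keeps the entries with both endpoints outside `B`
  let M' : Matrix α β ℝ := fun i j => if i ∈ B₁ ∨ j ∈ B₂ then 0 else M i j
  let M'' : Matrix α β ℝ := fun i j => if i ∈ B₁ ∨ j ∈ B₂ then M i j else 0
  have hsplit : M = M' + M'' := by
    ext i j
    simp only [M', M'', Matrix.add_apply]
    split_ifs <;> simp
  have habsσ : ∀ i, |σ i| = 1 := fun i => by rcases hσ i with h | h <;> simp [h]
  have habsφ : ∀ j, |φ j| = 1 := fun j => by rcases hφ j with h | h <;> simp [h]
  ------------------------------------------------------------------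
  -- (1) the `B`-part costs at most one per edge meeting `B`
  ------------------------------------------------------------------
  have hB : σ ⬝ᵥ (M'' *ᵥ φ) ≤ ((Finset.univ.filter fun e => src e ∈ B₁ ∨ dst e ∈ B₂).card : ℝ) := by
    have h1 : σ ⬝ᵥ (M'' *ᵥ φ) = ∑ i, ∑ j, σ i * M'' i j * φ j := by
      simp only [dotProduct, Matrix.mulVec, Finset.mul_sum, mul_assoc]
    have h2 : ∀ i j, σ i * M'' i j * φ j ≤
        ∑ e ∈ Finset.univ.filter (fun e => src e = i ∧ dst e = j),
          (if src e ∈ B₁ ∨ dst e ∈ B₂ then |s e| else 0) := by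
      intro i j
      calc σ i * M'' i j * φ j ≤ |σ i * M'' i j * φ j| := le_abs_self _
        _ = |M'' i j| := by rw [abs_mul, abs_mul, habsσ, habsφ, one_mul, mul_one]
        _ ≤ _ := by
          simp only [M'']
          by_cases hij : i ∈ B₁ ∨ j ∈ B₂
          · rw [if_pos hij, hM i j]
            refine (Finset.abs_sum_le_sum_abs _ _).trans (Finset.sum_le_sum fun e he => ?_)
            simp only [Finset.mem_filter, Finset.mem_univ, true_and] at he
            rw [he.1, he.2, if_pos hij]
          · rw [if_neg hij, abs_zero]
            exact Finset.sum_nonneg fun e _ => by split_ifs <;> simp [abs_nonneg]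
    calc σ ⬝ᵥ (M'' *ᵥ φ) = ∑ i, ∑ j, σ i * M'' i j * φ j := h1
      _ ≤ ∑ i, ∑ j, ∑ e ∈ Finset.univ.filter (fun e => src e = i ∧ dst e = j),
            (if src e ∈ B₁ ∨ dst e ∈ B₂ then |s e| else 0) :=
          Finset.sum_le_sum fun i _ => Finset.sum_le_sum fun j _ => h2 i j
      _ = ∑ e, (if src e ∈ B₁ ∨ dst e ∈ B₂ then |s e| else 0) := sum_sum_fiber_eq src dst _
      _ ≤ ∑ e, (if src e ∈ B₁ ∨ dst e ∈ B₂ then (1 : ℝ) else 0) := by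
          refine Finset.sum_le_sum fun e _ => ?_
          split_ifs
          · exact hs e
          · exact le_rfl
      _ = ((Finset.univ.filter fun e => src e ∈ B₁ ∨ dst e ∈ B₂).card : ℝ) := by
          simp [Finset.sum_boole]
  ------------------------------------------------------------------
  -- (2) the outside-`B` part: discrepancy bound for all 0/1 pairs, then DiscToCut
  ------------------------------------------------------------------
  -- the graph `G'`: `G` restricted to the vertices outside `B` (vertices of `B` isolated)
  let outB : α ⊕ β → Prop := Sum.elim (fun i => i ∉ B₁) (fun j => j ∉ B₂)
  let G' : SimpleGraph (α ⊕ β) :=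
    { Adj := fun x y => G.Adj x y ∧ outB x ∧ outB y
      symm := ⟨fun x y hxy => ⟨hxy.1.symm, hxy.2.2, hxy.2.1⟩⟩
      loopless := ⟨fun x hxx => G.irrefl hxx.1⟩ }
  have hG'adj : ∀ x y, G'.Adj x y ↔ G.Adj x y ∧ outB x ∧ outB y := fun _ _ => Iff.rfl
  have hle : G' ≤ G := fun x y hxy => ((hG'adj x y).1 hxy).1
  -- support of `M'` lies in `G'`
  have hsupp : ∀ i j, M' i j ≠ 0 → G'.Adj (Sum.inl i) (Sum.inr j) := by
    intro i j hij
    simp only [M'] at hij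
    by_cases hb : i ∈ B₁ ∨ j ∈ B₂
    · exact absurd (if_pos hb) hij
    · rw [if_neg hb, hM i j] at hij
      obtain ⟨e, he, _⟩ := Finset.exists_ne_zero_of_sum_ne_zero hij
      simp only [Finset.mem_filter, Finset.mem_univ, true_and] at he
      refine (hG'adj _ _).2 ⟨?_, ?_, ?_⟩
      · rw [← he.1, ← he.2]; exact hG e
      · simp only [outB, Sum.elim_inl]; exact fun h => hb (Or.inl h)
      · simp only [outB, Sum.elim_inr]; exact fun h => hb (Or.inr h)
  -- support of `M'` lies in `V₁ × V₂`
  have hM'supp : ∀ i j, M' i j ≠ 0 → i ∈ V₁ ∧ j ∈ V₂ := by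
    intro i j hij
    simp only [M'] at hij
    by_cases hb : i ∈ B₁ ∨ j ∈ B₂
    · exact absurd (if_pos hb) hij
    · rw [if_neg hb] at hij; exact hMsupp i j hij
  -- the discrepancy hypothesis for `G'`-connected pairs of `M'`
  have hconnD : ∀ u : α → ℝ, ∀ v : β → ℝ, (∀ i, u i = 0 ∨ u i = 1) → (∀ j, v j = 0 ∨ v j = 1) →
      (G'.induce {x | Sum.elim u v x = 1}).Connected →
      |u ⬝ᵥ (M' *ᵥ v)| ≤ γ * Real.sqrt ((∑ i, u i) * (∑ j, v j)) := by
    intro u v hu hv hconn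
    set W₁ : Finset α := Finset.univ.filter fun i => u i = 1 with hW₁
    set W₂ : Finset β := Finset.univ.filter fun j => v j = 1 with hW₂
    have hu_ind : ∀ i, u i = if i ∈ W₁ then 1 else 0 := by
      intro i; rcases hu i with h | h <;> simp [hW₁, h]
    have hv_ind : ∀ j, v j = if j ∈ W₂ then 1 else 0 := by
      intro j; rcases hv j with h | h <;> simp [hW₂, h]
    have hsumu : ∑ i, u i = (W₁.card : ℝ) := by
      rw [Finset.sum_congr rfl (fun i _ => hu_ind i), Finset.sum_boole]; simp
    have hsumv : ∑ j, v j = (W₂.card : ℝ) := by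
      rw [Finset.sum_congr rfl (fun j _ => hv_ind j), Finset.sum_boole]; simp
    -- trivial cases: one side empty
    by_cases hW₁e : W₁ = ∅
    · have : u = 0 := funext fun i => by rw [hu_ind i, hW₁e]; simp
      rw [this, zero_dotProduct, abs_zero]; exact mul_nonneg hγ (Real.sqrt_nonneg _)
    by_cases hW₂e : W₂ = ∅
    · have : v = 0 := funext fun j => by rw [hv_ind j, hW₂e]; simp
      rw [this, Matrix.mulVec_zero, dotProduct_zero, abs_zero]; exact mul_nonneg hγ (Real.sqrt_nonneg _)
    obtain ⟨i₀, hi₀⟩ := Finset.nonempty_iff_ne_empty.2 hW₁e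
    obtain ⟨j₀, hj₀⟩ := Finset.nonempty_iff_ne_empty.2 hW₂e
    -- the joint support
    set X : Set (α ⊕ β) := {x | Sum.elim u v x = 1} with hXdef
    have hXmem : ∀ x, x ∈ X ↔ Sum.elim (fun i => i ∈ W₁) (fun j => j ∈ W₂) x := by
      intro x; cases x with
      | inl i => simp [hXdef, hW₁]
      | inr j => simp [hXdef, hW₂]
    have hi₀X : (Sum.inl i₀ : α ⊕ β) ∈ X := (hXmem _).2 (by simpa using hi₀)
    have hj₀X : (Sum.inr j₀ : α ⊕ β) ∈ X := (hXmem _).2 (by simpa using hj₀)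
    -- every vertex of `X` is outside `B`: it has a `G'`-edge inside the connected set `X`
    have key : ∀ (p q : X) (w : (G'.induce X).Walk p q), p.1 ≠ q.1 → outB p.1 := by
      intro p q w hpq
      cases w with
      | nil => exact absurd rfl hpq
      | cons hadj _ => exact ((hG'adj _ _).1 (SimpleGraph.induce_adj.1 hadj)).2.1
    have houtX : ∀ x, x ∈ X → outB x := by
      intro x hx
      obtain ⟨y, hy, hxy⟩ : ∃ y, y ∈ X ∧ x ≠ y := by
        by_cases h : x = Sum.inl i₀
        · exact ⟨Sum.inr j₀, hj₀X, by rw [h]; exact Sum.inl_ne_inr⟩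
        · exact ⟨Sum.inl i₀, hi₀X, h⟩
      obtain ⟨w⟩ := hconn.preconnected ⟨x, hx⟩ ⟨y, hy⟩
      exact key _ _ w hxy
    have hdisj₁ : Disjoint W₁ B₁ := by
      rw [Finset.disjoint_left]; intro i hi
      have := houtX (Sum.inl i) ((hXmem _).2 (by simpa using hi))
      simpa [outB] using this
    have hdisj₂ : Disjoint W₂ B₂ := by
      rw [Finset.disjoint_left]; intro j hj
      have := houtX (Sum.inr j) ((hXmem _).2 (by simpa using hj))
      simpa [outB] using this
    -- `G'`-connected ⇒ `G`-connected (same vertex set)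
    have hconnG : (G.induce {x | Sum.elim (fun i => i ∈ W₁) (fun j => j ∈ W₂) x}).Connected := by
      have hXeq : X = {x | Sum.elim (fun i => i ∈ W₁) (fun j => j ∈ W₂) x} := Set.ext hXmem
      rw [← hXeq]
      exact hconn.mono (fun p q hpq => hle (SimpleGraph.induce_adj.1 hpq))
    have hbound := hgood W₁ W₂ hdisj₁ hdisj₂ hconnG
    -- `uᵀM'v = Σ_{W₁} Σ_{W₂} M i j` (all entries between `W₁` and `W₂` are outside `B`)
    have hform : u ⬝ᵥ (M' *ᵥ v) = ∑ i ∈ W₁, ∑ j ∈ W₂, M i j := by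
      have : u ⬝ᵥ (M' *ᵥ v) = ∑ i, ∑ j, u i * M' i j * v j := by
        simp only [dotProduct, Matrix.mulVec, Finset.mul_sum, mul_assoc]
      rw [this]
      rw [← Finset.sum_subset (Finset.subset_univ W₁)]
      · refine Finset.sum_congr rfl fun i hi => ?_
        rw [← Finset.sum_subset (Finset.subset_univ W₂)]
        · refine Finset.sum_congr rfl fun j hj => ?_
          have hi' : i ∉ B₁ := Finset.disjoint_left.1 hdisj₁ hi
          have hj' : j ∉ B₂ := Finset.disjoint_left.1 hdisj₂ hj
          have hij : ¬ (i ∈ B₁ ∨ j ∈ B₂) := by tauto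
          simp [hu_ind i, hv_ind j, hi, hj, M', hij]
        · intro j _ hj; simp [hv_ind j, hj]
      · intro i _ hi
        exact Finset.sum_eq_zero fun j _ => by simp [hu_ind i, hi]
    rw [hform, hsumu, hsumv]
    exact hbound
  have hall := disc_of_connected_pairs M' G' hsupp hγ hconnD
  have hcut := discToCut_supported M' V₁ V₂ hM'supp hγ hall σ φ hσ hφ
  ------------------------------------------------------------------
  -- (3) assemble
  ------------------------------------------------------------------
  have hdecomp : σ ⬝ᵥ (M *ᵥ φ) = σ ⬝ᵥ (M' *ᵥ φ) + σ ⬝ᵥ (M'' *ᵥ φ) := by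
    rw [hsplit, Matrix.add_mulVec, dotProduct_add]
  rw [hdecomp]
  have h1 : σ ⬝ᵥ (M' *ᵥ φ) ≤ 2 * γ * Real.sqrt ((V₁.card : ℝ) * (V₂.card : ℝ)) :=
    (le_abs_self _).trans hcut
  linarith

/-- COROLLARY (the form used in PROOF-SFM-BL §6 (iv)): if the spot was DENSE AT EXTRACTION,
`#E > 60γ·√(|V₁||V₂|)` (`γ_sp = 60γ′`), then `σᵀMφ < #E/30 + #{edges meeting B}`. -/
theorem spot_cut_lt_of_dense {α β E : Type*} [Fintype α] [Fintype β] [Fintype E] [DecidableEq α]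
    [DecidableEq β]
    (src : E → α) (dst : E → β) (V₁ : Finset α) (V₂ : Finset β) (hE : ∀ e, src e ∈ V₁ ∧ dst e ∈ V₂)
    (s : E → ℝ) (hs : ∀ e, |s e| ≤ 1)
    (M : Matrix α β ℝ)
    (hM : ∀ i j, M i j = ∑ e ∈ Finset.univ.filter (fun e => src e = i ∧ dst e = j), s e)
    (G : SimpleGraph (α ⊕ β)) (hG : ∀ e, G.Adj (Sum.inl (src e)) (Sum.inr (dst e)))
    {γ : ℝ} (hγ : 0 ≤ γ) (B₁ : Finset α) (B₂ : Finset β)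
    (hgood : ∀ (W₁ : Finset α) (W₂ : Finset β), Disjoint W₁ B₁ → Disjoint W₂ B₂ →
      (G.induce {x | Sum.elim (fun i => i ∈ W₁) (fun j => j ∈ W₂) x}).Connected →
      |∑ i ∈ W₁, ∑ j ∈ W₂, M i j| ≤ γ * Real.sqrt ((W₁.card : ℝ) * (W₂.card : ℝ)))
    (hdense : 60 * γ * Real.sqrt ((V₁.card : ℝ) * (V₂.card : ℝ)) < Fintype.card E)
    (σ : α → ℝ) (φ : β → ℝ) (hσ : ∀ i, σ i = 1 ∨ σ i = -1) (hφ : ∀ j, φ j = 1 ∨ φ j = -1) :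
    σ ⬝ᵥ (M *ᵥ φ) < (Fintype.card E : ℝ) / 30
      + ((Finset.univ.filter fun e => src e ∈ B₁ ∨ dst e ∈ B₂).card : ℝ) := by
  have h := spot_cut_le src dst V₁ V₂ hE s hs M hM G hG hγ B₁ B₂ hgood σ φ hσ hφ
  have h2 : 2 * γ * Real.sqrt ((V₁.card : ℝ) * (V₂.card : ℝ)) < (Fintype.card E : ℝ) / 30 := by
    linarith
  linarith

end Summit.PneNP.PneNP.Theorems.SfmBl
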